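import Mathlib
import Literature.NumberTheory.GaloisRepresentations.GaloisRep

/-!
# Trace limits IV — rigidity of endoscopic components: a quantitative uniqueness lemma by Newton
# iteration of idempotent lifts in the group algebra (route `PhantomRMYoshida`, crux
# `ResiduallyYoshidaLifting` = stmt-Langlands-13639, line `endoscopic-crossing-euler`, Stub 4)

Companion of `…TraceLimit{,Endo,Pseudo}.lean` (`--supports stmt-Langlands-13639`).  The endo-removal
step of Stub 4 `stub_weightTwoClassicality` is reduced there to the MATCHED CONVERGENCE of one
endoscopic component (`stub_endoOfComponentLimit`): along approximants `tr r'_n = tr a_n + tr d_n`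
of `tr ρ`, the traces `tr a_n` should be uniformly Cauchy.  This file proves the analytic core of
that convergence — valid over the NON-discrete valuation ring `ℤ̄_p` of `ℚ̄_p`, for every `p`, with
no loss of precision — an elementary substitute for the uniqueness half of Bellaïche–Chenevier's
Prop. 1.5.1 (uniqueness of the decomposition of a residually multiplicity-free pseudocharacter):

* `norm_trace_sub_trace_le_of_residualIdempotent` (**quantitative uniqueness of endoscopic
  components**, registered as `stub_endoComponentRigidity`).  Let `a, a' : Γ → GL_m(ℤ̄_p)` and
  `d, d' : Γ → GL_{m'}(ℤ̄_p)` be homomorphisms of a group with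
  `‖(tr a + tr d)(g) - (tr a' + tr d')(g)‖ ≤ ε` for all `g`, and suppose ONE element `x₀ ∈ ℤ̄_p[Γ]`
  acts residually as the identity through `a` and `a'` and as zero through `d` and `d'` (all entries
  of `a(x₀) - 1`, `d(x₀)`, `a'(x₀) - 1`, `d'(x₀)` have norm `< 1`).  Then `‖tr a(g) - tr a'(g)‖ ≤ ε`
  for all `g`.  Proof: the Newton iteration `x ↦ f(x) = x²(3 - 2x)` in `ℤ̄_p[Γ]` squares the four
  error norms at each step (`f(y) - 1 = -(y-1)²(2y+1)`), so for `x_k = fᵏ(x₀)` and every `g`,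
  `tr a(g)` is within `q^{2^k}` of `T(x_k g)` where `T = tr a + tr d` is extended linearly to
  `ℤ̄_p[Γ]`, likewise `tr a'(g)` of `T'(x_k g)`, while `‖T(x_k g) - T'(x_k g)‖ ≤ ε` because `x_k`
  has integral coefficients; let `k → ∞`.  The residual hypothesis on `x₀` is where
  multiplicity-freeness enters: such an `x₀` exists as soon as the reductions of `a, a'` are
  conjugate irreducible, those of `d, d'` conjugate irreducible, and the two are non-isomorphic
  (Jacobson density) — to be supplied by the user of this file.

Nothing here is specific to `Γ_ℚ` or to continuity: `Γ` is any group, `ε` any real.  No definitions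
(entrywise bounds `∀ i j, ‖M i j‖ ≤ q` and the Newton step are written out).

References: J. Bellaïche, G. Chenevier, *Families of Galois representations and Selmer groups*,
Astérisque 324 (2009), Prop. 1.5.1; the Newton iteration for idempotent lifting is folklore
(T. Y. Lam, *A first course in noncommutative rings*, Thm. 21.28).
-/

noncomputable section

open scoped Matrix

namespace Summit.Langlands.Langlands.Cruxes.ResiduallyYoshidaLifting.EndoscopicCrossingEuler

set_option linter.dupNamespace false

variable {p : ℕ} [Fact p.Prime]

/-! ### Entrywise bounds `∀ i j, ‖M i j‖ ≤ q` for matrices over `ℚ̄_p` (ultrametric) -/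

section EntryBound

variable {m : Type} [Fintype m]

omit [Fintype m] in
/-- Ultrametric entrywise bound for sums. [folklore] -/
theorem entry_add_le {M N : Matrix m m (PadicAlgCl p)} {q q' : ℝ} (hM : ∀ i j, ‖M i j‖ ≤ q)
    (hN : ∀ i j, ‖N i j‖ ≤ q') : ∀ i j, ‖(M + N) i j‖ ≤ max q q' := fun i j =>
  (IsUltrametricDist.norm_add_le_max _ _).trans (max_le_max (hM i j) (hN i j))

omit [Fintype m] in
/-- Ultrametric entrywise bound for differences. [folklore] -/
theorem entry_sub_le {M N : Matrix m m (PadicAlgCl p)} {q q' : ℝ} (hM : ∀ i j, ‖M i j‖ ≤ q)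
    (hN : ∀ i j, ‖N i j‖ ≤ q') : ∀ i j, ‖(M - N) i j‖ ≤ max q q' := fun i j => by
  rw [Matrix.sub_apply, sub_eq_add_neg]
  exact (IsUltrametricDist.norm_add_le_max _ _).trans
    (max_le_max (hM i j) (by rw [norm_neg]; exact hN i j))

omit [Fintype m] in
/-- Entrywise bound for negation. [folklore] -/
theorem entry_neg_le {M : Matrix m m (PadicAlgCl p)} {q : ℝ} (hM : ∀ i j, ‖M i j‖ ≤ q) :
    ∀ i j, ‖(-M) i j‖ ≤ q := fun i j => by rw [Matrix.neg_apply, norm_neg]; exact hM i j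

/-- Ultrametric entrywise bound for products: `‖(MN)ᵢⱼ‖ ≤ maxₗ ‖Mᵢₗ‖ ‖Nₗⱼ‖ ≤ q q'`. [folklore] -/
theorem entry_mul_le {M N : Matrix m m (PadicAlgCl p)} {q q' : ℝ} (hM : ∀ i j, ‖M i j‖ ≤ q)
    (hN : ∀ i j, ‖N i j‖ ≤ q') (hq : 0 ≤ q) (hq' : 0 ≤ q') : ∀ i j, ‖(M * N) i j‖ ≤ q * q' :=
  fun i j => by
  rw [Matrix.mul_apply]
  refine IsUltrametricDist.norm_sum_le_of_forall_le_of_nonneg (mul_nonneg hq hq') fun l _ => ?_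
  rw [norm_mul]
  exact mul_le_mul (hM i l) (hN l j) (norm_nonneg _) hq

omit [Fintype m] in
/-- The identity matrix is integral. [folklore] -/
theorem entry_one_le [DecidableEq m] : ∀ i j, ‖(1 : Matrix m m (PadicAlgCl p)) i j‖ ≤ 1 :=
  fun i j => by rw [Matrix.one_apply]; split_ifs <;> simp

/-- The trace of an entrywise-bounded matrix is bounded by the same constant (ultrametric).
[folklore] -/
theorem norm_trace_le_of_entry_le {M : Matrix m m (PadicAlgCl p)} {q : ℝ} (hM : ∀ i j, ‖M i j‖ ≤ q)
    (hq : 0 ≤ q) : ‖M.trace‖ ≤ q :=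
  IsUltrametricDist.norm_sum_le_of_forall_le_of_nonneg hq fun i _ => hM i i

/-! ### The Newton step `f(y) = y²(3 - 2y)` squares the distances to `1` and to `0` -/

/-- `f(y) - 1 = -(y - 1)² (2y + 1)` for the Newton step `f(y) = y²(1 + (1 - y) + (1 - y))`. [folklore] -/
theorem newtonStep_sub_one {R : Type*} [Ring R] (y : R) :
    y ^ 2 * (1 + (1 - y) + (1 - y)) - 1 = -((y - 1) ^ 2 * (y + y + 1)) := by
  noncomm_ring

variable [DecidableEq m]

/-- **The Newton step squares the distance to `1`**: for an integral matrix `y` with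
`‖y - 1‖ ≤ q` entrywise, `‖f(y) - 1‖ ≤ q²` entrywise. [folklore] -/
theorem entry_newtonStep_sub_one_le {y : Matrix m m (PadicAlgCl p)} {q : ℝ}
    (hy : ∀ i j, ‖y i j‖ ≤ 1) (h : ∀ i j, ‖(y - 1) i j‖ ≤ q) (hq : 0 ≤ q) :
    ∀ i j, ‖(y ^ 2 * (1 + (1 - y) + (1 - y)) - 1 : Matrix m m (PadicAlgCl p)) i j‖ ≤ q ^ 2 := by
  have h2 : ∀ i j, ‖(y + y + 1 : Matrix m m (PadicAlgCl p)) i j‖ ≤ 1 := fun i j =>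
    (entry_add_le (entry_add_le hy hy) entry_one_le i j).trans (by simp)
  have hsq : ∀ i j, ‖((y - 1) ^ 2 : Matrix m m (PadicAlgCl p)) i j‖ ≤ q * q := by
    rw [sq]; exact entry_mul_le h h hq hq
  have h3 := entry_neg_le (entry_mul_le hsq h2 (mul_nonneg hq hq) zero_le_one)
  rw [mul_one, ← sq] at h3
  rwa [newtonStep_sub_one]

/-- **The Newton step squares the distance to `0`**: for an integral matrix `y` with `‖y‖ ≤ q`
entrywise, `‖f(y)‖ ≤ q²` entrywise. [folklore] -/
theorem entry_newtonStep_le {y : Matrix m m (PadicAlgCl p)} {q : ℝ}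
    (hy : ∀ i j, ‖y i j‖ ≤ 1) (h : ∀ i j, ‖y i j‖ ≤ q) (hq : 0 ≤ q) :
    ∀ i j, ‖(y ^ 2 * (1 + (1 - y) + (1 - y)) : Matrix m m (PadicAlgCl p)) i j‖ ≤ q ^ 2 := by
  have h1y : ∀ i j, ‖(1 - y : Matrix m m (PadicAlgCl p)) i j‖ ≤ 1 := fun i j =>
    (entry_sub_le entry_one_le hy i j).trans (by simp)
  have h3 : ∀ i j, ‖(1 + (1 - y) + (1 - y) : Matrix m m (PadicAlgCl p)) i j‖ ≤ 1 := fun i j =>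
    (entry_add_le (entry_add_le entry_one_le h1y) h1y i j).trans (by simp)
  have hsq : ∀ i j, ‖(y ^ 2 : Matrix m m (PadicAlgCl p)) i j‖ ≤ q * q := by
    rw [sq]; exact entry_mul_le h h hq hq
  have h4 := entry_mul_le hsq h3 (mul_nonneg hq hq) zero_le_one
  rwa [mul_one, ← sq] at h4

/-- Iterating the Newton step `y_{k+1} = f(y_k)` through integral matrices: `‖y_k - 1‖ ≤ q^{2^k}`
entrywise if `‖y_0 - 1‖ ≤ q`. [folklore] -/
theorem entry_newton_seq_sub_one_le {y : ℕ → Matrix m m (PadicAlgCl p)} {q : ℝ}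
    (hstep : ∀ k, y (k + 1) = y k ^ 2 * (1 + (1 - y k) + (1 - y k)))
    (hy : ∀ k i j, ‖y k i j‖ ≤ 1) (h : ∀ i j, ‖(y 0 - 1) i j‖ ≤ q) (hq : 0 ≤ q) (k : ℕ) :
    ∀ i j, ‖(y k - 1) i j‖ ≤ q ^ 2 ^ k := by
  induction k with
  | zero => simpa using h
  | succ k ih =>
    rw [hstep, Nat.pow_succ, pow_mul]
    exact entry_newtonStep_sub_one_le (hy k) ih (pow_nonneg hq _)

/-- Iterating the Newton step `y_{k+1} = f(y_k)` through integral matrices: `‖y_k‖ ≤ q^{2^k}`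
entrywise if `‖y_0‖ ≤ q`. [folklore] -/
theorem entry_newton_seq_le {y : ℕ → Matrix m m (PadicAlgCl p)} {q : ℝ}
    (hstep : ∀ k, y (k + 1) = y k ^ 2 * (1 + (1 - y k) + (1 - y k)))
    (hy : ∀ k i j, ‖y k i j‖ ≤ 1) (h : ∀ i j, ‖y 0 i j‖ ≤ q) (hq : 0 ≤ q) (k : ℕ) :
    ∀ i j, ‖y k i j‖ ≤ q ^ 2 ^ k := by
  induction k with
  | zero => simpa using h
  | succ k ih =>
    rw [hstep, Nat.pow_succ, pow_mul]
    exact entry_newtonStep_le (hy k) ih (pow_nonneg hq _)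

end EntryBound

/-! ### The rigidity theorem -/

section Rigidity

/-- A finite family of reals `< 1` and `≥ 0` is bounded by some `q ∈ [0, 1)`. [folklore] -/
theorem exists_bound_lt_one {ι : Type*} [Finite ι] (f : ι → ℝ) (hf0 : ∀ i, 0 ≤ f i) (hf : ∀ i, f i < 1) :
    ∃ q : ℝ, 0 ≤ q ∧ q < 1 ∧ ∀ i, f i ≤ q := by
  rcases isEmpty_or_nonempty ι with hι | hι
  · exact ⟨0, le_rfl, zero_lt_one, fun i => (IsEmpty.false i).elim⟩
  · obtain ⟨i₀, hi₀⟩ := Finite.exists_max f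
    exact ⟨f i₀, hf0 i₀, hf i₀, hi₀⟩

variable {Γ : Type} [Group Γ] {m m' : Type} [Fintype m] [DecidableEq m] [Fintype m'] [DecidableEq m']

omit [DecidableEq m] in
/-- `‖tr(P N)‖ ≤ δ` for `‖P‖ ≤ δ` and `‖N‖ ≤ 1` entrywise. [folklore] -/
theorem norm_trace_mul_le {P N : Matrix m m (PadicAlgCl p)} {δ : ℝ} (hP : ∀ i j, ‖P i j‖ ≤ δ)
    (hN : ∀ i j, ‖N i j‖ ≤ 1) (hδ : 0 ≤ δ) : ‖(P * N).trace‖ ≤ δ := by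
  have h := entry_mul_le hP hN hδ zero_le_one
  rw [mul_one] at h
  exact norm_trace_le_of_entry_le h hδ

/-- **Rigidity of endoscopic components (quantitative uniqueness).**  Let `Γ` be a group,
`𝒪 = ℤ̄_p` the valuation ring of `ℚ̄_p`, and `A, A' : 𝒪[Γ] → M_m(ℚ̄_p)`, `D, D' : 𝒪[Γ] → M_{m'}(ℚ̄_p)`
ring homomorphisms with integral values which are `𝒪`-linear on scalars (`X(c·1) = c·1`) — e.g.
the linear extensions of representations `Γ → GL(𝒪)`.  Write `T(g) = tr A(g) + tr D(g)`,
`T'(g) = tr A'(g) + tr D'(g)` (`g ∈ Γ ⊂ 𝒪[Γ]`) and assume `‖T(g) - T'(g)‖ ≤ ε` for all `g`.  If some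
`x₀ ∈ 𝒪[Γ]` is a RESIDUAL IDEMPOTENT SEPARATING THE COMPONENTS — all entries of `A(x₀) - 1`, `D(x₀)`,
`A'(x₀) - 1`, `D'(x₀)` have norm `< 1` — then `‖tr A(g) - tr A'(g)‖ ≤ ε` for all `g`.
Proof: Newton iteration `x_{k+1} = x_k²(3 - 2x_k)` in `𝒪[Γ]`; the four errors are `≤ q^{2^k}`
(`entry_newton_seq_sub_one_le`, `entry_newton_seq_le`); `tr A(g)` is within `q^{2^k}` of
`tr A(x_k g)`, `tr D(x_k g)` is within `q^{2^k}` of `0`, same primed; and the `𝒪`-linear functional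
`z ↦ T(z g) - T'(z g)` is bounded by `ε` on `𝒪[Γ]` (integral coefficients, ultrametric inequality).
[folklore] -/
theorem norm_trace_sub_trace_le_of_residualIdempotent
    (A A' : MonoidAlgebra (Valued.integer (PadicAlgCl p)) Γ →+* Matrix m m (PadicAlgCl p))
    (D D' : MonoidAlgebra (Valued.integer (PadicAlgCl p)) Γ →+* Matrix m' m' (PadicAlgCl p))
    (hA : ∀ x i j, ‖A x i j‖ ≤ 1) (hA' : ∀ x i j, ‖A' x i j‖ ≤ 1) (hD : ∀ x i j, ‖D x i j‖ ≤ 1)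
    (hD' : ∀ x i j, ‖D' x i j‖ ≤ 1)
    (hAc : ∀ c, A (MonoidAlgebra.single 1 c) = (c : PadicAlgCl p) • (1 : Matrix m m (PadicAlgCl p)))
    (hA'c : ∀ c, A' (MonoidAlgebra.single 1 c) = (c : PadicAlgCl p) • (1 : Matrix m m (PadicAlgCl p)))
    (hDc : ∀ c, D (MonoidAlgebra.single 1 c) = (c : PadicAlgCl p) • (1 : Matrix m' m' (PadicAlgCl p)))
    (hD'c : ∀ c, D' (MonoidAlgebra.single 1 c) = (c : PadicAlgCl p) • (1 : Matrix m' m' (PadicAlgCl p)))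
    {ε : ℝ}
    (hT : ∀ g : Γ, ‖((A (MonoidAlgebra.single g 1)).trace + (D (MonoidAlgebra.single g 1)).trace) -
      ((A' (MonoidAlgebra.single g 1)).trace + (D' (MonoidAlgebra.single g 1)).trace)‖ ≤ ε)
    (x₀ : MonoidAlgebra (Valued.integer (PadicAlgCl p)) Γ)
    (h₀A : ∀ i j, ‖(A x₀ - 1) i j‖ < 1) (h₀D : ∀ i j, ‖D x₀ i j‖ < 1)
    (h₀A' : ∀ i j, ‖(A' x₀ - 1) i j‖ < 1) (h₀D' : ∀ i j, ‖D' x₀ i j‖ < 1) (g : Γ) :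
    ‖(A (MonoidAlgebra.single g 1)).trace - (A' (MonoidAlgebra.single g 1)).trace‖ ≤ ε := by
  have hε : 0 ≤ ε := (norm_nonneg _).trans (hT 1)
  -- a common bound `q < 1` for the four initial errors
  obtain ⟨q₁, hq₁0, hq₁1, hq₁⟩ := exists_bound_lt_one (fun ij : m × m => ‖(A x₀ - 1) ij.1 ij.2‖)
    (fun _ => norm_nonneg _) (fun ij => h₀A ij.1 ij.2)
  obtain ⟨q₂, hq₂0, hq₂1, hq₂⟩ := exists_bound_lt_one (fun ij : m' × m' => ‖D x₀ ij.1 ij.2‖)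
    (fun _ => norm_nonneg _) (fun ij => h₀D ij.1 ij.2)
  obtain ⟨q₃, hq₃0, hq₃1, hq₃⟩ := exists_bound_lt_one (fun ij : m × m => ‖(A' x₀ - 1) ij.1 ij.2‖)
    (fun _ => norm_nonneg _) (fun ij => h₀A' ij.1 ij.2)
  obtain ⟨q₄, hq₄0, hq₄1, hq₄⟩ := exists_bound_lt_one (fun ij : m' × m' => ‖D' x₀ ij.1 ij.2‖)
    (fun _ => norm_nonneg _) (fun ij => h₀D' ij.1 ij.2)
  set q : ℝ := max (max q₁ q₂) (max q₃ q₄) with hqdef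
  have hq0 : 0 ≤ q := hq₁0.trans ((le_max_left _ _).trans (le_max_left _ _))
  have hq1 : q < 1 := max_lt (max_lt hq₁1 hq₂1) (max_lt hq₃1 hq₄1)
  -- the Newton sequence in the group algebra and its four images
  let x : ℕ → MonoidAlgebra (Valued.integer (PadicAlgCl p)) Γ :=
    fun k => Nat.rec x₀ (fun _ z => z ^ 2 * (1 + (1 - z) + (1 - z))) k
  have hx0 : x 0 = x₀ := rfl
  have hxs : ∀ k, x (k + 1) = x k ^ 2 * (1 + (1 - x k) + (1 - x k)) := fun k => rfl
  have himg : ∀ {n : Type} [Fintype n] [DecidableEq n]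
      (X : MonoidAlgebra (Valued.integer (PadicAlgCl p)) Γ →+* Matrix n n (PadicAlgCl p)) (k : ℕ),
      X (x (k + 1)) = X (x k) ^ 2 * (1 + (1 - X (x k)) + (1 - X (x k))) := by
    intro n _ _ X k
    simp only [hxs, map_mul, map_pow, map_add, map_sub, map_one]
  have hAk : ∀ k i j, ‖(A (x k) - 1) i j‖ ≤ q ^ 2 ^ k :=
    entry_newton_seq_sub_one_le (y := fun k => A (x k)) (himg A) (fun k => hA _)
      (fun i j => (hq₁ (i, j)).trans ((le_max_left _ _).trans (le_max_left _ _))) hq0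
  have hA'k : ∀ k i j, ‖(A' (x k) - 1) i j‖ ≤ q ^ 2 ^ k :=
    entry_newton_seq_sub_one_le (y := fun k => A' (x k)) (himg A') (fun k => hA' _)
      (fun i j => (hq₃ (i, j)).trans ((le_max_left _ _).trans (le_max_right _ _))) hq0
  have hDk : ∀ k i j, ‖D (x k) i j‖ ≤ q ^ 2 ^ k :=
    entry_newton_seq_le (y := fun k => D (x k)) (himg D) (fun k => hD _)
      (fun i j => (hq₂ (i, j)).trans ((le_max_right _ _).trans (le_max_left _ _))) hq0
  have hD'k : ∀ k i j, ‖D' (x k) i j‖ ≤ q ^ 2 ^ k :=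
    entry_newton_seq_le (y := fun k => D' (x k)) (himg D') (fun k => hD' _)
      (fun i j => (hq₄ (i, j)).trans ((le_max_right _ _).trans (le_max_right _ _))) hq0
  -- the `𝒪`-linear functional `z ↦ T(z g) - T'(z g)` is bounded by `ε` on `𝒪[Γ]`
  set s : MonoidAlgebra (Valued.integer (PadicAlgCl p)) Γ := MonoidAlgebra.single g 1 with hsdef
  have hL : ∀ z : MonoidAlgebra (Valued.integer (PadicAlgCl p)) Γ,
      ‖((A (z * s)).trace + (D (z * s)).trace) - ((A' (z * s)).trace + (D' (z * s)).trace)‖ ≤ ε := by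
    intro z
    induction z using MonoidAlgebra.induction_on with
    | hM γ =>
      have h1 : MonoidAlgebra.of (Valued.integer (PadicAlgCl p)) Γ γ * s = MonoidAlgebra.single (γ * g) 1 := by
        rw [MonoidAlgebra.of_apply, hsdef, MonoidAlgebra.single_mul_single, mul_one]
      rw [h1]
      exact hT (γ * g)
    | hadd y z hy hz =>
      rw [add_mul, map_add, map_add, map_add, map_add, Matrix.trace_add, Matrix.trace_add,
        Matrix.trace_add, Matrix.trace_add]
      have hdec : (A (y * s)).trace + (A (z * s)).trace + ((D (y * s)).trace + (D (z * s)).trace) -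
          ((A' (y * s)).trace + (A' (z * s)).trace + ((D' (y * s)).trace + (D' (z * s)).trace)) =
          (((A (y * s)).trace + (D (y * s)).trace) - ((A' (y * s)).trace + (D' (y * s)).trace)) +
          (((A (z * s)).trace + (D (z * s)).trace) - ((A' (z * s)).trace + (D' (z * s)).trace)) := by
        ring
      rw [hdec]
      exact (IsUltrametricDist.norm_add_le_max _ _).trans (max_le hy hz)
    | hsmul c y hy =>
      have hsm : ∀ {n : Type} [Fintype n] [DecidableEq n]
          (X : MonoidAlgebra (Valued.integer (PadicAlgCl p)) Γ →+* Matrix n n (PadicAlgCl p)),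
          (∀ c, X (MonoidAlgebra.single 1 c) = (c : PadicAlgCl p) • (1 : Matrix n n (PadicAlgCl p))) →
          (X (c • y * s)).trace = (c : PadicAlgCl p) * (X (y * s)).trace := by
        intro n _ _ X hXc
        rw [smul_mul_assoc, Algebra.smul_def, MonoidAlgebra.coe_algebraMap, Function.comp_apply,
          Algebra.algebraMap_self_apply, map_mul, hXc, smul_mul_assoc, one_mul, Matrix.trace_smul,
          smul_eq_mul]
      rw [hsm A hAc, hsm D hDc, hsm A' hA'c, hsm D' hD'c, ← mul_add, ← mul_add, ← mul_sub, norm_mul]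
      calc ‖(c : PadicAlgCl p)‖ * _ ≤ 1 * ε :=
            mul_le_mul (Valued.integer.mem_iff.mp c.2) hy (norm_nonneg _) zero_le_one
        _ = ε := one_mul ε
  -- the estimate at precision `q ^ 2 ^ k`, for every `k`
  have hk : ∀ k : ℕ, ‖(A s).trace - (A' s).trace‖ ≤ max ε (q ^ 2 ^ k) := by
    intro k
    have hδ : 0 ≤ q ^ 2 ^ k := pow_nonneg hq0 _
    have e1 : ‖(A (x k * s)).trace - (A s).trace‖ ≤ q ^ 2 ^ k := by
      have : A (x k * s) - A s = (A (x k) - 1) * A s := by rw [map_mul, sub_mul, one_mul]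
      rw [← Matrix.trace_sub, this]
      exact norm_trace_mul_le (hAk k) (hA s) hδ
    have e2 : ‖(A' (x k * s)).trace - (A' s).trace‖ ≤ q ^ 2 ^ k := by
      have : A' (x k * s) - A' s = (A' (x k) - 1) * A' s := by rw [map_mul, sub_mul, one_mul]
      rw [← Matrix.trace_sub, this]
      exact norm_trace_mul_le (hA'k k) (hA' s) hδ
    have e3 : ‖(D (x k * s)).trace‖ ≤ q ^ 2 ^ k := by
      rw [map_mul]; exact norm_trace_mul_le (hDk k) (hD s) hδ
    have e4 : ‖(D' (x k * s)).trace‖ ≤ q ^ 2 ^ k := by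
      rw [map_mul]; exact norm_trace_mul_le (hD'k k) (hD' s) hδ
    have hdec : (A s).trace - (A' s).trace =
        -((A (x k * s)).trace - (A s).trace) +
          (((A (x k * s)).trace + (D (x k * s)).trace) - ((A' (x k * s)).trace + (D' (x k * s)).trace)) +
          -(D (x k * s)).trace + (D' (x k * s)).trace + ((A' (x k * s)).trace - (A' s).trace) := by
      ring
    rw [hdec]
    refine (IsUltrametricDist.norm_add_le_max _ _).trans (max_le ?_ (e2.trans (le_max_right _ _)))
    refine (IsUltrametricDist.norm_add_le_max _ _).trans (max_le ?_ (e4.trans (le_max_right _ _)))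
    refine (IsUltrametricDist.norm_add_le_max _ _).trans (max_le ?_ ?_)
    · refine (IsUltrametricDist.norm_add_le_max _ _).trans (max_le ?_ ((hL _).trans (le_max_left _ _)))
      rw [norm_neg]; exact e1.trans (le_max_right _ _)
    · rw [norm_neg]; exact e3.trans (le_max_right _ _)
  -- let `k → ∞`
  by_contra hlt
  rw [not_le] at hlt
  have hpos : 0 < ‖(A s).trace - (A' s).trace‖ := hε.trans_lt hlt
  obtain ⟨k, hk'⟩ := ((tendsto_pow_atTop_nhds_zero_of_lt_one hq0 hq1).eventually
    (gt_mem_nhds hpos)).exists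
  have h2k : q ^ 2 ^ k ≤ q ^ k := pow_le_pow_of_le_one hq0 hq1.le Nat.lt_two_pow_self.le
  rcases le_max_iff.mp (hk k) with h | h
  · exact absurd h (not_le.mpr hlt)
  · exact absurd (h.trans h2k) (not_le.mpr hk')

/-- **Registered sub-goal `stub_endoComponentRigidity` of Stub 4** (the statement through which this
helper file lands, `--supports stmt-Langlands-13639`; = `norm_trace_sub_trace_le_of_residualIdempotent`
in closed form): quantitative uniqueness of endoscopic components in the presence of a residual
idempotent separating them. [folklore] -/
theorem stub_endoComponentRigidity :
    ∀ (p : ℕ) [Fact p.Prime] (Γ : Type) [Group Γ] (m m' : Type) [Fintype m] [DecidableEq m]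
      [Fintype m'] [DecidableEq m']
      (A A' : MonoidAlgebra (Valued.integer (PadicAlgCl p)) Γ →+* Matrix m m (PadicAlgCl p))
      (D D' : MonoidAlgebra (Valued.integer (PadicAlgCl p)) Γ →+* Matrix m' m' (PadicAlgCl p))
      (ε : ℝ) (x₀ : MonoidAlgebra (Valued.integer (PadicAlgCl p)) Γ),
      (∀ x i j, ‖A x i j‖ ≤ 1) → (∀ x i j, ‖A' x i j‖ ≤ 1) → (∀ x i j, ‖D x i j‖ ≤ 1) →
      (∀ x i j, ‖D' x i j‖ ≤ 1) →
      (∀ c, A (MonoidAlgebra.single 1 c) = (c : PadicAlgCl p) • (1 : Matrix m m (PadicAlgCl p))) →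
      (∀ c, A' (MonoidAlgebra.single 1 c) = (c : PadicAlgCl p) • (1 : Matrix m m (PadicAlgCl p))) →
      (∀ c, D (MonoidAlgebra.single 1 c) = (c : PadicAlgCl p) • (1 : Matrix m' m' (PadicAlgCl p))) →
      (∀ c, D' (MonoidAlgebra.single 1 c) = (c : PadicAlgCl p) • (1 : Matrix m' m' (PadicAlgCl p))) →
      (∀ g : Γ, ‖((A (MonoidAlgebra.single g 1)).trace + (D (MonoidAlgebra.single g 1)).trace) -
        ((A' (MonoidAlgebra.single g 1)).trace + (D' (MonoidAlgebra.single g 1)).trace)‖ ≤ ε) →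
      (∀ i j, ‖(A x₀ - 1) i j‖ < 1) → (∀ i j, ‖D x₀ i j‖ < 1) → (∀ i j, ‖(A' x₀ - 1) i j‖ < 1) →
      (∀ i j, ‖D' x₀ i j‖ < 1) →
      ∀ g : Γ, ‖(A (MonoidAlgebra.single g 1)).trace - (A' (MonoidAlgebra.single g 1)).trace‖ ≤ ε :=
  fun _ _ _ _ _ _ _ _ _ _ A A' D D' _ x₀ hA hA' hD hD' hAc hA'c hDc hD'c hT h₀A h₀D h₀A' h₀D' g =>
    norm_trace_sub_trace_le_of_residualIdempotent A A' D D' hA hA' hD hD' hAc hA'c hDc hD'c hT x₀ h₀A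
      h₀D h₀A' h₀D' g

end Rigidity

end Summit.Langlands.Langlands.Cruxes.ResiduallyYoshidaLifting.EndoscopicCrossingEuler

end
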